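import Summits.QuantumAdvantage.QuantumAdvantage.Theorems.NearExactIsExact.Negative.SkewProductCore

/-!
# `NearExactIsExact` (stmt-QuantumAdvantage-14043) — negative lemma: the REFLECTED PAIR on 6-flats with
  two quadratic directions (gen 42 disprover; the tool for the `naff = 4` stratum of BQ-11)

Third member of the reflected-pair family (`Negative/ReflectedFlatPair.lean`: two affine 5-flats — every
K-frame; `Negative/ReflectedPairGraph.lean`: 5-flats, second section affine but one quadratic coordinate —
the γ-frames).  Here the parametrising space is `𝔽₂⁶`, which buys one more degree of room
(Ax / McEliece at `(6,5)`): the second section may be `σ₁ = A ⊕ q₁·F₁ ⊕ q₂·F₂` with `A` affine, `q₁, q₂`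
quadratic and `F₁, F₂` constant vectors, because for cubic `c`
`c(a ⊕ λF₁ ⊕ μF₂) = c(a) ⊕ λ·Δ_{F₁}c(a) ⊕ μ·Δ_{F₂}c(a) ⊕ λμ·Δ_{F₂}Δ_{F₁}c(a)` has degrees `3, 2+2, 2+2,
2+2+1 = 5 < 6` after the substitution.  This is exactly the shape of the reflected section at `naff = 4`
(DISPROOF.md §48.12(c)): in the D2 normal forms of `π` and `π⁻¹`, reflecting the 6-flat `S₀ = {(u, Lu)}`
through a purely target-fibre vector `e` gives `σ₁ ⊕ σ₀ = affine ⊕ x₅(u)·F₅ ⊕ x₆(u)·F₆` with the two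
twisted target coordinates `x₅, x₆` quadratic.  So at `naff = 4` the degree conditions of the parity
argument are automatic and the kill reduces to a MASS condition on `S₁ ∩ U` (the dichotomy of §48.12(c)).

* `taylor_two_dirs` — the pointwise two-direction expansion above (Boolean form);
* `comp_deg_affine_two_dirs` — cubic ∘ (affine ⊕ q₁F₁ ⊕ q₂F₂) has degree `≤ 5` (any source dimension);
* `reflected_pair_six` — `c₁ ⊕ c₂∘π = U`, `σ₀ : 𝔽₂⁶ → 𝔽₂^n` affine with `π∘σ₀` quadratic,
  `σ₁ = A ⊕ q₁F₁ ⊕ q₂F₂`, `π∘σ₁ = π∘σ₀ ⊕ e` ⇒ `U` has even total mass on `σ₀, σ₁` (any `n`, any `π`).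

HONEST FRAMING: a kernel-checked negative lemma (the generic branch of an attack on `naff = 4` that is so
far a paper plan — no two-sided `naff = 4` map is known to the cell); NOT summit progress.
-/

set_option linter.dupNamespace false -- D-0017: single-problem summit ⇒ `QuantumAdvantage.QuantumAdvantage` by design

namespace Summit.QuantumAdvantage.QuantumAdvantage.Theorems.NearExactIsExact.Negative.ReflectedPairSix

open Finset
open Literature.Computability.QuantumComplexity
open Literature.Computability.QuantumComplexity.BuzetChailloux (bxor)
open Summit.QuantumAdvantage.QuantumAdvantage.Theorems.CubicForrelation.NearExactIsExact
  (fc_isDegLeFun_comp fc_deg_bxor stub_derivDegree te_isDegLeFun_band)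
open Summit.QuantumAdvantage.QuantumAdvantage.Theorems.NearExactIsExact.Negative.SkewProductCore

/-- `a ⊕ 0·F = a`. [folklore] -/
theorem bxor_false_smul {n : ℕ} (a F : Fin n → Bool) : bxor a (fun j => false && F j) = a := by
  funext j; simp [bxor]

/-- `a ⊕ 1·F = a ⊕ F`. [folklore] -/
theorem bxor_true_smul {n : ℕ} (a F : Fin n → Bool) : bxor a (fun j => true && F j) = bxor a F := by
  funext j; simp [bxor]

/-- Two-direction Taylor expansion of a Boolean function, pointwise:
`c(a ⊕ λF₁ ⊕ μF₂) = c a ⊕ λ·Δ_{F₁}c(a) ⊕ μ·Δ_{F₂}c(a) ⊕ λμ·Δ_{F₂}Δ_{F₁}c(a)`. [folklore] -/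
theorem taylor_two_dirs {n : ℕ} (c : (Fin n → Bool) → Bool) (a F₁ F₂ : Fin n → Bool) (l m : Bool) :
    c (bxor (bxor a (fun j => l && F₁ j)) (fun j => m && F₂ j)) =
      (c a ^^ (l && (c a ^^ c (bxor a F₁))) ^^ (m && (c a ^^ c (bxor a F₂))) ^^
        (l && (m && ((c a ^^ c (bxor a F₂)) ^^ (c (bxor a F₁) ^^ c (bxor (bxor a F₁) F₂)))))) := by
  cases l <;> cases m <;> simp only [bxor_false_smul, bxor_true_smul] <;>
    generalize c a = x <;> generalize c (bxor a F₁) = y <;> generalize c (bxor a F₂) = z <;>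
    generalize c (bxor (bxor a F₁) F₂) = w <;> revert x y z w <;> decide

/-- **Cubic ∘ (affine ⊕ two quadratic directions) has degree `≤ 5`.** [folklore] -/
theorem comp_deg_affine_two_dirs {m n : ℕ} (c : (Fin n → Bool) → Bool) (hc : IsDegLeFun 3 c)
    (A : (Fin m → Bool) → (Fin n → Bool)) (hA : ∀ j, IsDegLeFun 1 (fun v => A v j))
    (q₁ q₂ : (Fin m → Bool) → Bool) (hq₁ : IsDegLeFun 2 q₁) (hq₂ : IsDegLeFun 2 q₂)
    (F₁ F₂ : Fin n → Bool) :
    IsDegLeFun 5 (fun v => c (bxor (bxor (A v) (fun j => q₁ v && F₁ j)) (fun j => q₂ v && F₂ j))) := by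
  have h0 : IsDegLeFun 3 (fun v : Fin m → Bool => c (A v)) := fc_isDegLeFun_comp hc A hA (by norm_num)
  have h1 : IsDegLeFun 2 (fun v : Fin m → Bool => c (A v) ^^ c (bxor (A v) F₁)) :=
    fc_isDegLeFun_comp (stub_derivDegree n 2 c F₁ hc) A hA (by norm_num)
  have h2 : IsDegLeFun 2 (fun v : Fin m → Bool => c (A v) ^^ c (bxor (A v) F₂)) :=
    fc_isDegLeFun_comp (stub_derivDegree n 2 c F₂ hc) A hA (by norm_num)
  have h12 : IsDegLeFun 1 (fun v : Fin m → Bool => (c (A v) ^^ c (bxor (A v) F₂)) ^^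
      (c (bxor (A v) F₁) ^^ c (bxor (bxor (A v) F₁) F₂))) :=
    fc_isDegLeFun_comp (stub_derivDegree n 1 _ F₁ (stub_derivDegree n 2 c F₂ hc)) A hA (by norm_num)
  have e : (fun v => c (bxor (bxor (A v) (fun j => q₁ v && F₁ j)) (fun j => q₂ v && F₂ j))) =
      fun v => (c (A v) ^^ (q₁ v && (c (A v) ^^ c (bxor (A v) F₁))) ^^
        (q₂ v && (c (A v) ^^ c (bxor (A v) F₂))) ^^
        (q₁ v && (q₂ v && ((c (A v) ^^ c (bxor (A v) F₂)) ^^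
          (c (bxor (A v) F₁) ^^ c (bxor (bxor (A v) F₁) F₂)))))) :=
    funext fun v => taylor_two_dirs c (A v) F₁ F₂ (q₁ v) (q₂ v)
  rw [e]
  exact fc_deg_bxor (fc_deg_bxor (fc_deg_bxor (h0.mono (by norm_num))
    ((te_isDegLeFun_band hq₁ h1).mono (by norm_num))) ((te_isDegLeFun_band hq₂ h2).mono (by norm_num)))
    ((te_isDegLeFun_band hq₁ (te_isDegLeFun_band hq₂ h12)).mono (by norm_num))

/-- **REFLECTED PAIR on 6-flats.** If `c₁ ⊕ c₂∘π = U` with `c₁, c₂` cubic, `σ₀ : 𝔽₂⁶ → 𝔽₂^n` affine with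
`π∘σ₀` quadratic, `σ₁ = A ⊕ q₁F₁ ⊕ q₂F₂` (`A` affine, `q₁, q₂` quadratic, `F₁, F₂` constant) and
`π∘σ₁ = π∘σ₀ ⊕ e`, then `U` has even total mass on `σ₀, σ₁`. [folklore] -/
theorem reflected_pair_six {n : ℕ} (π : (Fin n → Bool) → (Fin n → Bool))
    (c₁ c₂ : (Fin n → Bool) → Bool) (h₁ : IsDegLeFun 3 c₁) (h₂ : IsDegLeFun 3 c₂)
    (U : (Fin n → Bool) → Bool) (hres : ∀ z, (c₁ z ^^ c₂ (π z)) = U z)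
    (σ₀ : (Fin 6 → Bool) → (Fin n → Bool)) (hσ₀ : ∀ j, IsDegLeFun 1 (fun v => σ₀ v j))
    (A : (Fin 6 → Bool) → (Fin n → Bool)) (hA : ∀ j, IsDegLeFun 1 (fun v => A v j))
    (q₁ q₂ : (Fin 6 → Bool) → Bool) (hq₁ : IsDegLeFun 2 q₁) (hq₂ : IsDegLeFun 2 q₂)
    (F₁ F₂ : Fin n → Bool) (σ₁ : (Fin 6 → Bool) → (Fin n → Bool))
    (hσ₁ : ∀ v, σ₁ v = bxor (bxor (A v) (fun j => q₁ v && F₁ j)) (fun j => q₂ v && F₂ j))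
    (hπ : ∀ j, IsDegLeFun 2 (fun v => π (σ₀ v) j)) (e : Fin n → Bool)
    (hrefl : ∀ v, π (σ₁ v) = bxor (π (σ₀ v)) e) :
    ∑ v, ind (U (σ₀ v)) + ∑ v, ind (U (σ₁ v)) = 0 := by
  have hc0 : IsDegLeFun 3 (fun v : Fin 6 → Bool => c₁ (σ₀ v)) :=
    fc_isDegLeFun_comp h₁ σ₀ hσ₀ (by norm_num)
  have hc1 : IsDegLeFun 5 (fun v : Fin 6 → Bool => c₁ (σ₁ v)) := by
    have e' : (fun v : Fin 6 → Bool => c₁ (σ₁ v)) =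
        fun v => c₁ (bxor (bxor (A v) (fun j => q₁ v && F₁ j)) (fun j => q₂ v && F₂ j)) :=
      funext fun v => by rw [hσ₁ v]
    rw [e']; exact comp_deg_affine_two_dirs c₁ h₁ A hA q₁ q₂ hq₁ hq₂ F₁ F₂
  have hD : IsDegLeFun 4 (fun v : Fin 6 → Bool => c₂ (π (σ₀ v)) ^^ c₂ (bxor (π (σ₀ v)) e)) :=
    fc_isDegLeFun_comp (stub_derivDegree n 2 c₂ e h₂) (fun v => π (σ₀ v)) hπ (by norm_num)
  have hpt : ∀ v : Fin 6 → Bool, ind (U (σ₀ v)) + ind (U (σ₁ v)) =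
      ind (c₁ (σ₀ v)) + ind (c₁ (σ₁ v)) + ind (c₂ (π (σ₀ v)) ^^ c₂ (bxor (π (σ₀ v)) e)) := by
    intro v
    rw [← hres (σ₀ v), ← hres (σ₁ v), hrefl v, ind_xor, ind_xor, ind_xor]
    ring
  rw [← sum_add_distrib, sum_congr rfl (fun v _ => hpt v), sum_add_distrib, sum_add_distrib,
    sum_ind_eq_zero_of_deg_five (hc0.mono (by norm_num)), sum_ind_eq_zero_of_deg_five hc1,
    sum_ind_eq_zero_of_deg_five (hD.mono (by norm_num)), add_zero, add_zero]

end Summit.QuantumAdvantage.QuantumAdvantage.Theorems.NearExactIsExact.Negative.ReflectedPairSix
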